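import Summits.CriticalPhenomena.PercolationContinuityZ3.Theorems.PercNearOneGluingNoHeavyQuantDepthOneTripleHeavySingle
import HarnessLib

/-!
# QUANT lane R8, T-DEC: THE IDENTICAL GLUED TRIPLE AT ITS TRUE FLOOR REDUCES TO ONE SMALL "LIFT" LAW — `ρ ∗ gate_o ρ` (a depth-1 sub-forest
# beside its own gated copy) SDEC ABOVE its tree-OK floor; the compound identity `gate_a ρ ∗ gate_b ρ = gate_{a+b−ab}(ρ ∗ gate_{ab/(a+b−ab)} ρ)`
# (prim-quant-census-2 gen 79)

builds on p205010 (kernel theorem, internal audit signed; external expert review pending)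

Support file (`--supports stmt-CriticalPhenomena-4575`), QUANT lane census seat prim-quant-census-2 (gen 79); memo
`run/shared/lean/prim/quant/prim-quant-census-2-g79/GLUEDPAIR-G79.md` §9.  Theorems only, standard axioms, no sorries, no definitions.

WHY.  For three identical depth-1 siblings `t = gate_q ρ` neither root-identity orientation reaches the true floor `q·y` (heavy single needs `q₃ ≥ 2q−q²`;
the generic step stops at `q²·y`, `…QuantDepthOneTripleGeneric`).  But `t ∗ t` IS a single gated tree: **`gate_lconv_gate_same`** —
`gate_a ρ ∗ gate_b ρ = gate_{Q}(ρ ∗ gate_{ab/Q} ρ)`, `Q = a + b − ab` (pure algebra), so `t ∗ t = gate_{2q−q²} H`, `H = ρ ∗ gate_{q²/(2q−q²)} ρ`, and the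
two-root identity (`sdec_twoRoot_of_opened`, opening the heavier root `2q−q² ≥ q`) gives the triple at the TRUE floor `q·g` from SDEC of `H` and of the
opened forest `H ∗ gate_{q/Q} ρ` — both at the floor `qg/Q = g/(2−q)`, which is ABOVE their tree-OK floor `(q²/Q)·g`:
* **`sdec_gluedThree_of_lift`** — for `ρ = blobLaw [(k,g),(r,1)]` (`0<q,g<1`): `SDEC (qg/Q) (2M) H` ∧ `SDEC (qg/Q) (3M) (H ∗ gate_{q/Q} ρ)`
  ⟹ `SDEC (q·g) (3M) ((t ∗ t) ∗ t)` (`M = r + k`), i.e. the identical glued triple of ANY shape at its true floor; **`sdec_gluedThree_of_highLift`**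
  asks the first hypothesis only for the outer gates `a ∈ (Q, 1]`.
* **`sdec_lift_low_gates`** — the first hypothesis is already kernel for outer gates `a ≤ Q` (it is `sdec_gluedTwo` re-read through the identity:
  `gate_a H = gate_{a/Q}(t∗t)`); what remains of it is the HIGH-GATE part `a ∈ (Q, 1]` (`sdec_of_low_and_high`).
NUMERICS (guidance, exact-rate LP, code/liftL.py, lift.py, hprime.py): `ρ ∗ gate_o ρ` is SDEC at EVERY floor up to `0.999 ×` its affordability floor
`(1+o)(r+kg)/(2(r+k))` for all `o ∈ (0,1]` on 1 701 (shape, o, g) cases × 8 outer gates × all layers, 0 failures ("CONJECTURE L"); the two hypotheses above hold on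
245/245 resp. 245/245 (shape, q, g) cases; whereas `δ_r ∗ gate_o ρ` and `blob ∗ gate_o ρ` alone FAIL at the lifted floor (113/245, 111/245): the lift needs the
whole sub-forest `ρ` as the sure partner.  So the true-floor long-tail triple (census-1 g31/g32's open small-width case) is ONE explicit 5-atom certificate family away.

HONEST STATUS.  Conditional reduction; `L`, the identical long-tail triple at its true floor, `SiblingStep`, `FarTreeRow` OPEN; RATE class (log\*) / honest
sentence of `run/shared/lean/prim/quant/README.md` unchanged.  [this work].  Nothing here is cited as a published result.  The gluing rows served
[cite: KozmaNitzan2024, Conjecture 3 (p. 15)]; product measure [cite: Grimmett1999, §1.3 p. 10].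
-/

noncomputable section

open scoped BigOperators

namespace Summit.CriticalPhenomena.PercolationContinuityZ3.Theorems
namespace Quant
namespace LawDec

open Finset

/-! ### The compound identity for two gated copies of one law -/

/-- `gate` as a linear combination of the law and `δ₀`. [this work] -/
theorem gate_eq_lin (μ : ℕ → ℝ) (q : ℝ) :
    gate μ q = fun i => q * μ i + (1 - q) * (if i = 0 then (1 : ℝ) else 0) :=
  funext fun i => gate_apply μ q i

/-- **THE COMPOUND OF TWO GATED COPIES**: for a law `ρ` on `{0..M}` (vanishing above `M`) and gates `a, b` with `Q = a + b − ab ≠ 0`: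
`gate_a ρ ∗ gate_b ρ = gate_Q(ρ ∗ gate_{ab/Q} ρ)` — the width-2 forest of two copies is ONE gated tree whose sub-forest is `ρ` beside its `(ab/Q)`-gated
copy. [this work] -/
theorem gate_lconv_gate_same (M : ℕ) (ρ : ℕ → ℝ) (hρM : ∀ h, M < h → ρ h = 0) (a b : ℝ) (hQ : a + b - a * b ≠ 0) :
    lconv M M (gate ρ a) (gate ρ b) = gate (lconv M M ρ (gate ρ (a * b / (a + b - a * b)))) (a + b - a * b) := by
  funext h
  have hδM : ∀ n, M < n → (fun i : ℕ => if i = 0 then (1 : ℝ) else 0) n = 0 := fun n hn => by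
    dsimp only; rw [if_neg (by omega)]
  rw [gate_eq_lin ρ a, gate_eq_lin ρ b, lconv_lin_left, lconv_lin_right, lconv_lin_right, lconv_delta_right M M ρ hρM h,
    lconv_delta_left M M ρ hρM h, lconv_delta_left M M _ hδM h, gate_apply, gate_eq_lin ρ (a * b / (a + b - a * b)), lconv_lin_right,
    lconv_delta_right M M ρ hρM h]
  have e1 : (a + b - a * b) * (a * b / (a + b - a * b)) = a * b := by field_simp
  have e2 : (a + b - a * b) * (1 - a * b / (a + b - a * b)) = a + b - 2 * (a * b) := by field_simp; ring
  calc a * (b * lconv M M ρ ρ h + (1 - b) * ρ h) + (1 - a) * (b * ρ h + (1 - b) * (if h = 0 then (1 : ℝ) else 0))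
      = (a * b) * lconv M M ρ ρ h + (a + b - 2 * (a * b)) * ρ h + (1 - (a + b - a * b)) * (if h = 0 then (1 : ℝ) else 0) := by ring
    _ = (a + b - a * b) * (a * b / (a + b - a * b)) * lconv M M ρ ρ h + (a + b - a * b) * (1 - a * b / (a + b - a * b)) * ρ h
          + (1 - (a + b - a * b)) * (if h = 0 then (1 : ℝ) else 0) := by rw [e1, e2]
    _ = _ := by ring

/-! ### SDEC from the low-gate and the high-gate parts -/

/-- SDEC at `y` from the outer gates `≤ Q` and the outer gates in `(Q, 1]` separately. [this work] -/
theorem sdec_of_low_and_high {y Q : ℝ} {M : ℕ} {μ : ℕ → ℝ}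
    (hlow : ∀ a : ℝ, 0 < a → a ≤ Q → a ≤ 1 → ∀ j : ℕ, j < M → DECAt (a * y) j M (gate μ a))
    (hhigh : ∀ a : ℝ, Q < a → a ≤ 1 → ∀ j : ℕ, j < M → DECAt (a * y) j M (gate μ a)) : SDEC y M μ := by
  intro a ha0 ha1 j hj
  rcases le_or_gt a Q with h | h
  · exact hlow a ha0 h ha1 j hj
  · exact hhigh a h ha1 j hj

/-- **THE LOW-GATE PART OF THE LIFT IS `sdec_gluedTwo`**: for `ρ = {r: 1−g, r+k: g}`, `0 < q, g < 1`, `Q = 2q − q²`, `H = ρ ∗ gate_{q²/Q} ρ` and every outer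
gate `0 < a ≤ Q`: `gate_a H = gate_{a/Q}(t ∗ t)` is DEC at floor `a·(qg/Q)` at every layer (the width-2 theorem at `qg`). [this work] -/
theorem sdec_lift_low_gates (r k : ℕ) {q g : ℝ} (hq0 : 0 < q) (hq1 : q < 1) (hg0 : 0 < g) (hg1 : g < 1)
    (a : ℝ) (ha0 : 0 < a) (haQ : a ≤ q + q - q * q) (j : ℕ) (hj : j < (r + k) + (r + k)) :
    DECAt (a * (q * g / (q + q - q * q))) j ((r + k) + (r + k))
      (gate (lconv (r + k) (r + k) (blobLaw [(k, g), (r, 1)]) (gate (blobLaw [(k, g), (r, 1)]) (q * q / (q + q - q * q)))) a) := by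
  set Q : ℝ := q + q - q * q with hQ
  have hQq : q ≤ Q := by rw [hQ]; nlinarith
  have hQ0 : 0 < Q := lt_of_lt_of_le hq0 hQq
  obtain ⟨_, aM, _, _⟩ := glued_blob_laws r k hg0.le hg1.le
  have hpair := sdec_gluedTwo r k r k hq0 hq1 hg0 hg1 hq0 hq1 hg0 hg1 (mul_pos hq0 hg0) le_rfl le_rfl
  rw [gate_lconv_gate_same (r + k) _ aM q q hQ0.ne'] at hpair
  have h := hpair (a / Q) (div_pos ha0 hQ0) ((div_le_one hQ0).2 haQ) j hj
  rw [gate_gate] at h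
  have e1 : a / Q * Q = a := div_mul_cancel₀ a hQ0.ne'
  have e2 : a / Q * (q * g) = a * (q * g / Q) := by ring
  rw [e1, e2] at h
  exact h

/-! ### The reduction -/

/-- **THE IDENTICAL GLUED TRIPLE AT ITS TRUE FLOOR FROM THE LIFT.**  `ρ = blobLaw [(k,g),(r,1)]`, `t = gate ρ q`, `0 < q, g < 1`, `Q = 2q − q²`,
`H = ρ ∗ gate_{q²/Q} ρ`.  IF `H` is SDEC at `qg/Q` (`= g/(2−q)`; the outer gates `≤ Q` are `sdec_lift_low_gates`) AND the opened forest `H ∗ gate_{q/Q} ρ` is SDEC at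
`qg/Q`, THEN `(t ∗ t) ∗ t` is SDEC at the TRUE floor `q·g` — any shape `(r, k)`, long tails included. [this work] -/
theorem sdec_gluedThree_of_lift (r k : ℕ) {q g : ℝ} (hq0 : 0 < q) (hq1 : q < 1) (hg0 : 0 < g) (hg1 : g < 1)
    (hI : SDEC (q * g / (q + q - q * q)) ((r + k) + (r + k))
      (lconv (r + k) (r + k) (blobLaw [(k, g), (r, 1)]) (gate (blobLaw [(k, g), (r, 1)]) (q * q / (q + q - q * q)))))
    (hII : SDEC (q * g / (q + q - q * q)) ((r + k) + (r + k) + (r + k))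
      (lconv ((r + k) + (r + k)) (r + k)
        (lconv (r + k) (r + k) (blobLaw [(k, g), (r, 1)]) (gate (blobLaw [(k, g), (r, 1)]) (q * q / (q + q - q * q))))
        (gate (blobLaw [(k, g), (r, 1)]) (q / (q + q - q * q))))) :
    SDEC (q * g) ((r + k) + (r + k) + (r + k))
      (lconv ((r + k) + (r + k)) (r + k)
        (lconv (r + k) (r + k) (gate (blobLaw [(k, g), (r, 1)]) q) (gate (blobLaw [(k, g), (r, 1)]) q))
        (gate (blobLaw [(k, g), (r, 1)]) q)) := by
  set Q : ℝ := q + q - q * q with hQ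
  set ρ : ℕ → ℝ := blobLaw [(k, g), (r, 1)] with hρ
  set o : ℝ := q * q / Q with ho
  have hQq : q ≤ Q := by rw [hQ]; nlinarith
  have hQ0 : 0 < Q := lt_of_lt_of_le hq0 hQq
  have hQ1 : Q < 1 := by rw [hQ]; nlinarith
  have ho0 : 0 < o := div_pos (mul_pos hq0 hq0) hQ0
  have ho1 : o ≤ 1 := by rw [ho, div_le_one hQ0, hQ]; nlinarith
  obtain ⟨a0, aM, a1, amn⟩ := glued_blob_laws r k hg0.le hg1.le
  -- t ∗ t = gate_Q H
  rw [gate_lconv_gate_same (r + k) ρ aM q q hQ0.ne']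
  -- law facts of H
  have hl : ∀ p ∈ [((k : ℕ), g), (r, (1 : ℝ))], g ≤ p.2 ∧ p.2 ≤ 1 := by
    intro p hp
    simp only [List.mem_cons, List.mem_nil_iff, or_false] at hp
    rcases hp with rfl | rfl
    · exact ⟨le_rfl, hg1.le⟩
    · exact ⟨hg1.le, le_rfl⟩
  have hρh : InBlobHull g ((r : ℝ) + k * g) (r + k) ρ := by
    have h := inBlobHull_blobLaw g [((k : ℕ), g), (r, (1 : ℝ))] hl (M := r + k) (by rw [blobTop_glued])
    have em : blobMean [((k : ℕ), g), (r, (1 : ℝ))] = (r : ℝ) + k * g := by simp [blobMean]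
    rwa [em] at h
  obtain ⟨H0, HM, H1, Hmn⟩ := gatedTwo_laws hg0.le hg0.le hρh hρh zero_le_one le_rfl ho0.le ho1
  rw [gate_one] at H0 HM H1 Hmn
  have hS₂ : SDEC g (r + k) ρ := sdec_of_inBlobHull hg0 hg1 hρh
  -- floors
  have hy0 : 0 < q * g / Q := div_pos (mul_pos hq0 hg0) hQ0
  have hyg : q * g / Q ≤ g := by
    rw [div_le_iff₀ hQ0]; nlinarith [mul_le_mul_of_nonneg_right hQq hg0.le]
  have hy1 : q * g / Q < 1 := lt_of_le_of_lt hyg hg1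
  have hr0 : (0 : ℝ) ≤ r := Nat.cast_nonneg r
  have hta₂ : g * ((r + k : ℕ) : ℝ) ≤ ∑ h ∈ Finset.range (r + k + 1), (h : ℝ) * ρ h := by
    rw [amn]; push_cast; nlinarith
  have hta₁ : q * g / Q * (((r + k) + (r + k) : ℕ) : ℝ)
      ≤ ∑ h ∈ Finset.range ((r + k) + (r + k) + 1), (h : ℝ) * lconv (r + k) (r + k) ρ (gate ρ o) h := by
    rw [Hmn, one_mul]
    -- (qg/Q)·2(r+k) ≤ (1 + o)(r + kg), with 1 + o = 2q/Q
    have hQne : Q ≠ 0 := hQ0.ne'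
    have e1 : (1 : ℝ) + o = 2 * q / Q := by
      rw [ho, eq_div_iff hQne, add_mul, div_mul_cancel₀ _ hQne, hQ]; ring
    have e2 : ((r : ℝ) + k * g) + o * ((r : ℝ) + k * g) = (2 * q / Q) * ((r : ℝ) + k * g) := by rw [← e1]; ring
    rw [e2]; push_cast
    rw [div_mul_eq_mul_div, div_mul_eq_mul_div, div_le_div_iff_of_pos_right hQ0]
    have h1 : g * (r : ℝ) ≤ r := by nlinarith
    have h2 : q * (g * (r : ℝ)) ≤ q * r := mul_le_mul_of_nonneg_left h1 hq0.le
    linarith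
  have hxQ : q * g ≤ Q * (q * g / Q) := by rw [mul_div_cancel₀ _ hQ0.ne']
  exact sdec_twoRoot_of_opened (q * g / Q) g (q * g / Q) (q * g) Q q ((r + k) + (r + k)) (r + k) _ ρ hy0 hy1 hg0 hg1 hy0.le hy1 hq0 hQq hQ1
    (mul_pos hq0 hg0) H0 HM H1 hta₁ a0 aM a1 hta₂ hI hS₂ hII hxQ le_rfl hxQ


/-- **… WITH ONLY THE HIGH-GATE PART OF THE FIRST HYPOTHESIS** (outer gates `a ∈ (Q, 1]`, `Q = 2q − q²`; the gates `≤ Q` are `sdec_lift_low_gates`).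
[this work] -/
theorem sdec_gluedThree_of_highLift (r k : ℕ) {q g : ℝ} (hq0 : 0 < q) (hq1 : q < 1) (hg0 : 0 < g) (hg1 : g < 1)
    (hIhigh : ∀ a : ℝ, q + q - q * q < a → a ≤ 1 → ∀ j : ℕ, j < (r + k) + (r + k) →
      DECAt (a * (q * g / (q + q - q * q))) j ((r + k) + (r + k))
        (gate (lconv (r + k) (r + k) (blobLaw [(k, g), (r, 1)]) (gate (blobLaw [(k, g), (r, 1)]) (q * q / (q + q - q * q)))) a))
    (hII : SDEC (q * g / (q + q - q * q)) ((r + k) + (r + k) + (r + k))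
      (lconv ((r + k) + (r + k)) (r + k)
        (lconv (r + k) (r + k) (blobLaw [(k, g), (r, 1)]) (gate (blobLaw [(k, g), (r, 1)]) (q * q / (q + q - q * q))))
        (gate (blobLaw [(k, g), (r, 1)]) (q / (q + q - q * q))))) :
    SDEC (q * g) ((r + k) + (r + k) + (r + k))
      (lconv ((r + k) + (r + k)) (r + k)
        (lconv (r + k) (r + k) (gate (blobLaw [(k, g), (r, 1)]) q) (gate (blobLaw [(k, g), (r, 1)]) q))
        (gate (blobLaw [(k, g), (r, 1)]) q)) :=
  sdec_gluedThree_of_lift r k hq0 hq1 hg0 hg1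
    (sdec_of_low_and_high (fun a ha0 haQ _ j hj => sdec_lift_low_gates r k hq0 hq1 hg0 hg1 a ha0 haQ j hj) hIhigh) hII

end LawDec
end Quant
end Summit.CriticalPhenomena.PercolationContinuityZ3.Theorems
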